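import Summits.QuantumFields.BalabanUV.T4Continuum.Spine.NE7.QLaBlockAvgLinear

/-!
# Spine/NE7/QLaBlockAvgOneStep — THE FRAMED ONE-STEP ESTIMATE for the printed prescription `blockAvg expMeanLogSU` on `SU(N)`:
# to first order about the flat configuration the framed average is the mean transported bond; the remainder is second order

Cell `pub-balaban-gaps` (YM blitz Y1, track G2, seat `ne7`, generation 8); text of record
`run/shared/lean/pub/pub-balaban-gaps/ne/NE7.md` v8 §4nonies, census rows R52–R54.  Twenty-eighth `Spine/NE7/` file; fourth of the
files `QLaBlockAvgFramedStep` ∕ `QLaBlockAvgEML` ∕ `QLaBlockAvgLinear` ∕ `QLaBlockAvgOneStep` ∕ `QLaBlockAvgContraction` of generation 8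
(see the first for WHY).

THE ESTIMATE.  For a level-`j` configuration `V` over `SU(N)` with `dist1 V_b ≤ ρ` for all bonds, `ℓρ < δ_N`, `ℓρ ≤ ½`
(`ℓ = 2(d+1)L` bounds the length of every walk of the one-step map), define the FRAME `λ(V, y)` at a coarse site as the printed
small-loop average (`expMeanLogSU`, [Balaban1987RG1] (0.4)) of the staircase transporters `V(Γ)`, `Γ ∈ G(y, x)`, `x ∈ B(y)` (the
analogue of [Balaban1985Averaging] (62)/(110) `\overline{R_{0,y}V₁}` for B12's contour system), and the FRAMED AVERAGE
`F(V) := (Ū)^{λ⁻¹}`, `F(V)(c) = λ(V,c₋)⁻¹ · Ū(c) · λ(V,c₊)` (the analogue of the double-bar average (89) `V̿₁`).  Then for every coarse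
bond `c`:
* `norm_framed_sub_one_sub_le`: `‖F(V)(c) − 1 − |Idx|⁻¹Σ_i Lin([x_i, x_i′])‖ ≤ 109·ℓρ·(rem_c)` where `rem_c` collects the mean masses of
  the staircases at `c₋`, `c₊`, the loops and the segment — the FIRST-ORDER CANCELLATION of the staircases against the frames and of
  the segment `c` against `Ū(c) = (…)U(c)` (the linear bookkeeping `QLaBlockAvgLinear.meanLin_loop`), every factor expanded to second
  order (`QLaBlockAvgFramedStep`, `QLaBlockAvgEML`); this is [Balaban1985Averaging] Prop. 3 (122)–(123)/(125) IN KIND («its Taylor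
  expansion begins with a first-order polynomial … the main term (125) `Σ_{x∈B(c₋)} L^{−(d+1)}(R_{0,c₋}A)([x, x′])`»), at the flat
  background, for the (0.4) contour system, in the one-point (not Lipschitz) form;
* `dist1_framed_le_sup`: `dist1 F(V)(c) ≤ 16ℓρ` (the framed field stays small: the next domain);
* `dist1_framed_le`: `dist1 F(V)(c) ≤ segMass(c) + 109ℓρ·remMass(c)` — summed over the coarse bonds in the sequel `QLaBlockAvgContraction`
  (`tv(1, F(V)) ≤ (θ + 872·d·ℓ²·ρ)·tv(1, V)`, `θ = L^{1−d}`).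

HONEST FRAMING.  Elementary second-order bookkeeping on OUR sup-ball domains; the one-point form about `V = 1` only (NOT the
two-configuration NE1a-STEP of row O3c, NOT Bałaban's Props 3–5, NOT the (52)/(158) domains verbatim); nothing of Bałaban's densities,
R-operation or (1.100) insert.  (QL-a) NOT IN PRINT ([Balaban1989LargeFieldII] p. 356); NE7 NOT proved; spine 0∕9; fixed finite T⁴ —
NOT ℝ⁴, NOT infinite volume, NOT a mass gap, NOT Clay.
-/

noncomputable section

open Finset
open scoped BigOperators Matrix Matrix.Norms.L2Operator

namespace Summit.QuantumFields.BalabanUV.T4Continuum.Spine.NE7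

open Literature.MathematicalPhysics.QuantumFieldTheory.Balaban1983to89
open Literature.MathematicalPhysics.QuantumFieldTheory.Balaban1983to89.T4Continuum
open Literature.MathematicalPhysics.QuantumFieldTheory.Balaban1983to89.T4AvgSensitivity
open Literature.MathematicalPhysics.QuantumFieldTheory.Balaban1983to89.T4AvgDerivBound
open Literature.MathematicalPhysics.QuantumFieldTheory.Balaban1983to89.BlockAveraging (Idx off loopHol Small corr avgFun blockAvg
  blockAvg_avg blockOf_src_of_mem_walk)
open Literature.MathematicalPhysics.QuantumFieldTheory.Balaban1983to89.AveragingRT (axialAvg)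
open ExpMeanLog

section SUN

variable {n : Type*} [Fintype n] [DecidableEq n] [Nonempty n]
variable {P : Params} {j : ℕ}

/-! ## §1 Frames and the framed one-step map -/

/-- THE STAIRCASE FAMILY at the coarse site `y`: the transporters `V(Γ)`, `Γ ∈ G(y, x)`, `x ∈ B(y)`, indexed by the index set of
(0.4) (the second ordering is a dummy). [cite: Balaban1987RG1, (0.3) p.252] -/
def stairFam (V : GaugeField P j (Matrix.specialUnitaryGroup n ℂ)) (y : Site P (j + 1)) : Idx P → Matrix.specialUnitaryGroup n ℂ :=
  fun i => holAt V (walk (emb y) (stairWord i.2.1 (off i.1)))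

/-- THE FRAME `λ(V, y)`: the printed small-loop average of the staircase family (the (0.4)-analogue of [Balaban1985Averaging] (62)
`v(y) = exp[−i Σ_{x∈B(y)} L^{−d} (1/i) log(R_{0,y}V₁)(Γ_{y,x})]`, up to the sign convention). [cite: Balaban1985Averaging, (62) p.28] -/
def frame (V : GaugeField P j (Matrix.specialUnitaryGroup n ℂ)) (y : Site P (j + 1)) : Matrix.specialUnitaryGroup n ℂ :=
  (expMeanLogSU (n := n)).avg (stairFam V y)

/-- The frame gauge transformation `y ↦ λ(V, y)⁻¹` of `T^{(j+1)}`. [cite: Balaban1985Averaging, (89) p.31] -/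
def frameTransf (V : GaugeField P j (Matrix.specialUnitaryGroup n ℂ)) : GaugeTransf P (j + 1) (Matrix.specialUnitaryGroup n ℂ) :=
  fun y => (frame V y)⁻¹

/-- THE FRAMED ONE-STEP AVERAGE `F(V) = (Ū)^{λ⁻¹}` of the printed prescription `blockAvg expMeanLogSU` (the (0.4)-analogue of the
double-bar average [Balaban1985Averaging] (89) `V̿₁(c) = (\overline{R_{0,c₋}V₁})⁻¹ Ṽ₁(c) R̄_{0,c} \overline{R_{0,c₊}V₁}` at the flat
background). [cite: Balaban1985Averaging, (89) p.31] -/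
def framed (V : GaugeField P j (Matrix.specialUnitaryGroup n ℂ)) : GaugeField P (j + 1) (Matrix.specialUnitaryGroup n ℂ) :=
  GaugeField.gaugeAct (frameTransf V) ((blockAvg (P := P) (j := j) (expMeanLogSU (n := n))).avg V)

/-- The framed average at `c` is the four-factor product `λ(c₋)⁻¹ · corr(c) · U(c) · λ(c₊)`. [folklore] -/
theorem framed_apply (V : GaugeField P j (Matrix.specialUnitaryGroup n ℂ)) (c : PBond P (j + 1)) :
    framed V c = (frame V c.src)⁻¹ * corr (expMeanLogSU (n := n)) V c * axialAvg V c * frame V c.tgt := by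
  simp only [framed, frameTransf, GaugeField.gaugeAct, blockAvg_avg, avgFun, inv_inv, mul_assoc]

/-! ## §2 Lengths and masses of the walks of the one-step map on a sup-ball -/

/-- `ℓ = 2(d+1)L`: a bound for the length of every walk entering the one-step map. [folklore] -/
def ell (P : Params) : ℕ := 2 * (P.d + 1) * P.L

/-- On a sup-ball `dist1 V_b ≤ ρ`, a walk carries mass at most its length times `ρ`. [folklore] -/
theorem walkMass_le_length_mul (V : GaugeField P j (Matrix.specialUnitaryGroup n ℂ)) {ρ : ℝ} (hV : ∀ b, dist1 (V b) ≤ ρ) :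
    ∀ γ : List (LStep P j), walkMass V γ ≤ γ.length * ρ
  | [] => by simp
  | s :: γ => by
    rw [walkMass_cons, List.length_cons, Nat.cast_succ, add_mul, one_mul, add_comm]
    exact add_le_add (walkMass_le_length_mul V hV γ) (hV _)

/-- The loop walks of (0.4) carry mass `≤ ℓρ`. [folklore] -/
theorem walkMass_loop_le (V : GaugeField P j (Matrix.specialUnitaryGroup n ℂ)) {ρ : ℝ} (hρ : 0 ≤ ρ) (hV : ∀ b, dist1 (V b) ≤ ρ)
    (c : PBond P (j + 1)) (i : Idx P) :
    walkMass V (walk (emb c.src) (loopWord P.L c.dir (off i.1) i.2.1 i.2.2)) ≤ ell P * ρ := by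
  refine (walkMass_le_length_mul V hV _).trans (mul_le_mul_of_nonneg_right ?_ hρ)
  rw [length_walk]
  exact_mod_cast length_loopWord_le (P := P) c.dir i.1 i.2.1 i.2.2

/-- The staircase walks carry mass `≤ ℓρ`. [folklore] -/
theorem walkMass_stair_le (V : GaugeField P j (Matrix.specialUnitaryGroup n ℂ)) {ρ : ℝ} (hρ : 0 ≤ ρ) (hV : ∀ b, dist1 (V b) ≤ ρ)
    (y : Site P (j + 1)) (i : Idx P) :
    walkMass V (walk (emb y) (stairWord i.2.1 (off i.1))) ≤ ell P * ρ := by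
  refine (walkMass_le_length_mul V hV _).trans (mul_le_mul_of_nonneg_right ?_ hρ)
  rw [length_walk]
  have h := length_stairWord_le (P := P) i.2.1 i.1
  have : P.d * P.L ≤ ell P := by unfold ell; nlinarith
  exact_mod_cast h.trans this

/-- The segment walk carries mass `≤ ℓρ`. [folklore] -/
theorem walkMass_ax_le (V : GaugeField P j (Matrix.specialUnitaryGroup n ℂ)) {ρ : ℝ} (hρ : 0 ≤ ρ) (hV : ∀ b, dist1 (V b) ≤ ρ)
    (x : Site P j) (μ : Fin P.d) :
    walkMass V (walk x (List.replicate P.L (μ, true))) ≤ ell P * ρ := by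
  refine (walkMass_le_length_mul V hV _).trans (mul_le_mul_of_nonneg_right ?_ hρ)
  rw [length_walk, List.length_replicate]
  have : P.L ≤ ell P := by unfold ell; nlinarith
  exact_mod_cast this

/-! ### the mean masses entering the remainder -/

/-- The mean (over the index set of (0.4)) of a real-valued function. [folklore] -/
def meanR (f : Idx P → ℝ) : ℝ := (Fintype.card (Idx P) : ℝ)⁻¹ * ∑ i, f i

/-- Means are monotone. [folklore] -/
theorem meanR_mono {f g : Idx P → ℝ} (h : ∀ i, f i ≤ g i) : meanR f ≤ meanR g :=
  mul_le_mul_of_nonneg_left (Finset.sum_le_sum fun i _ => h i) (inv_nonneg.mpr (Nat.cast_nonneg _))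

/-- A mean of non-negative terms is non-negative. [folklore] -/
theorem meanR_nonneg {f : Idx P → ℝ} (h : ∀ i, 0 ≤ f i) : 0 ≤ meanR f :=
  mul_nonneg (inv_nonneg.mpr (Nat.cast_nonneg _)) (Finset.sum_nonneg fun i _ => h i)

/-- A mean is at most a uniform bound. [folklore] -/
theorem meanR_le_of_le {f : Idx P → ℝ} {a : ℝ} (h : ∀ i, f i ≤ a) : meanR f ≤ a := mean_le_of_le h

/-- Constants come out of means. [folklore] -/
theorem meanR_mul_left (a : ℝ) (f : Idx P → ℝ) : meanR (fun i => a * f i) = a * meanR f := by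
  unfold meanR; rw [← Finset.mul_sum]; ring

/-- Means add. [folklore] -/
theorem meanR_add (f g : Idx P → ℝ) : meanR (fun i => f i + g i) = meanR f + meanR g := by
  unfold meanR; rw [Finset.sum_add_distrib, mul_add]

/-- THE MEAN STAIRCASE MASS at `y`. [folklore] -/
def stairMass (V : GaugeField P j (Matrix.specialUnitaryGroup n ℂ)) (y : Site P (j + 1)) : ℝ :=
  meanR fun i => walkMass V (walk (emb y) (stairWord i.2.1 (off i.1)))

/-- THE MEAN LOOP MASS at `c`. [folklore] -/
def loopMass (V : GaugeField P j (Matrix.specialUnitaryGroup n ℂ)) (c : PBond P (j + 1)) : ℝ :=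
  meanR fun i => walkMass V (walk (emb c.src) (loopWord P.L c.dir (off i.1) i.2.1 i.2.2))

/-- THE SEGMENT MASS at `c`. [folklore] -/
def axMass (V : GaugeField P j (Matrix.specialUnitaryGroup n ℂ)) (c : PBond P (j + 1)) : ℝ :=
  walkMass V (walk (emb c.src) (List.replicate P.L (c.dir, true)))

/-- THE MEAN TRANSPORTED-BOND MASS at `c` (the first-order term's size). [folklore] -/
def segMass (V : GaugeField P j (Matrix.specialUnitaryGroup n ℂ)) (c : PBond P (j + 1)) : ℝ :=
  meanR fun i => walkMass V (walk (Site.blockSite c.src i.1) (List.replicate P.L (c.dir, true)))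

/-- THE REMAINDER MASS at `c`: staircases at both ends, loops, segment. [folklore] -/
def remMass (V : GaugeField P j (Matrix.specialUnitaryGroup n ℂ)) (c : PBond P (j + 1)) : ℝ :=
  stairMass V c.src + loopMass V c + axMass V c + stairMass V c.tgt

/-! ## §3 Each factor to second order -/

section Factors

variable (V : GaugeField P j (Matrix.specialUnitaryGroup n ℂ)) {ρ : ℝ}

/-- **A PRINTED AVERAGE OF TRANSPORTS TO SECOND ORDER** (the common core of the frame and of the correction factor): for any
finite family of walks `γ_i` of masses `≤ η` (`η < δ_N`, `η ≤ ½`), the printed small-loop average of the transports satisfies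
`‖E(𝒰_{γ_i}(V)) − 1 − |I|⁻¹Σ_i Lin_{γ_i}(V)‖ ≤ 9η·|I|⁻¹Σ_i mass(γ_i)` and `‖E(𝒰_{γ_i}(V)) − 1‖ ≤ 5·|I|⁻¹Σ_i mass(γ_i)`
(`QLaBlockAvgEML.norm_avg_sub_one_sub_mean_le` + `QLaBlockAvgFramedStep.norm_hol_sub_one_sub_walkLin_le`). [folklore] -/
theorem avg_hol_estimates {ι : Type*} [Fintype ι] [Nonempty ι] (γ : ι → List (LStep P j)) {η : ℝ}
    (hmass : ∀ i, walkMass V (γ i) ≤ η) (hδ : η < deltaSU n) (h2 : η ≤ 1 / 2) :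
    ‖(((expMeanLogSU (n := n)).avg (fun i => holAt V (γ i)) : Matrix.specialUnitaryGroup n ℂ) : MatA n) - 1
        - ((Fintype.card ι : ℂ))⁻¹ • ∑ i, walkLin V (γ i)‖ ≤ 9 * η * ((Fintype.card ι : ℝ)⁻¹ * ∑ i, walkMass V (γ i)) ∧
      ‖(((expMeanLogSU (n := n)).avg (fun i => holAt V (γ i)) : Matrix.specialUnitaryGroup n ℂ) : MatA n) - 1‖
        ≤ 5 * ((Fintype.card ι : ℝ)⁻¹ * ∑ i, walkMass V (γ i)) := by
  have hc0 : 0 ≤ (Fintype.card ι : ℝ)⁻¹ := inv_nonneg.mpr (Nat.cast_nonneg _)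
  have hW : ∀ i, dist1 (holAt V (γ i)) ≤ η := fun i => (dist1_holAt_le_walkMass V _).trans (hmass i)
  have hmean : (Fintype.card ι : ℝ)⁻¹ * ∑ i, dist1 (holAt V (γ i)) ≤ (Fintype.card ι : ℝ)⁻¹ * ∑ i, walkMass V (γ i) :=
    mul_le_mul_of_nonneg_left (Finset.sum_le_sum fun i _ => dist1_holAt_le_walkMass V _) hc0
  have hη0 : 0 ≤ η := (walkMass_nonneg V _).trans (hmass (Classical.arbitrary ι))
  set Fm : MatA n := (((expMeanLogSU (n := n)).avg (fun i => holAt V (γ i)) : Matrix.specialUnitaryGroup n ℂ) : MatA n) with hFm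
  set Mn : MatA n := ((Fintype.card ι : ℂ))⁻¹ •
    ∑ i, (((holAt V (γ i) : Matrix.specialUnitaryGroup n ℂ) : MatA n) - 1) with hMn
  have h8 : ‖Fm - 1 - Mn‖ ≤ 8 * η * ((Fintype.card ι : ℝ)⁻¹ * ∑ i, dist1 (holAt V (γ i))) :=
    norm_avg_sub_one_sub_mean_le (fun i => holAt V (γ i)) hδ h2 hW
  have h5 : ‖Fm - 1‖ ≤ 5 * ((Fintype.card ι : ℝ)⁻¹ * ∑ i, dist1 (holAt V (γ i))) :=
    norm_avg_sub_one_le (fun i => holAt V (γ i)) hδ h2 hW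
  refine ⟨?_, h5.trans (by linarith)⟩
  have hlin : ‖Mn - ((Fintype.card ι : ℂ))⁻¹ • ∑ i, walkLin V (γ i)‖ ≤ η * ((Fintype.card ι : ℝ)⁻¹ * ∑ i, walkMass V (γ i)) := by
    rw [hMn, ← smul_sub, ← Finset.sum_sub_distrib]
    refine (norm_mean_le _).trans ?_
    have hsum : ∑ i, ‖(((holAt V (γ i) : Matrix.specialUnitaryGroup n ℂ)) : MatA n) - 1 - walkLin V (γ i)‖
        ≤ ∑ i, η * walkMass V (γ i) := Finset.sum_le_sum fun i _ =>
      (norm_hol_sub_one_sub_walkLin_le V _).trans (by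
        rw [pow_two]; exact mul_le_mul_of_nonneg_right (hmass i) (walkMass_nonneg V _))
    rw [← Finset.mul_sum] at hsum
    calc (Fintype.card ι : ℝ)⁻¹ * ∑ i, ‖(((holAt V (γ i) : Matrix.specialUnitaryGroup n ℂ)) : MatA n) - 1 - walkLin V (γ i)‖
        ≤ (Fintype.card ι : ℝ)⁻¹ * (η * ∑ i, walkMass V (γ i)) := mul_le_mul_of_nonneg_left hsum hc0
      _ = η * ((Fintype.card ι : ℝ)⁻¹ * ∑ i, walkMass V (γ i)) := by ring
  have hsplit : Fm - 1 - ((Fintype.card ι : ℂ))⁻¹ • ∑ i, walkLin V (γ i)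
      = (Fm - 1 - Mn) + (Mn - ((Fintype.card ι : ℂ))⁻¹ • ∑ i, walkLin V (γ i)) := by abel
  rw [hsplit]
  refine (norm_add_le _ _).trans ?_
  have hη8 : 8 * η * ((Fintype.card ι : ℝ)⁻¹ * ∑ i, dist1 (holAt V (γ i)))
      ≤ 8 * η * ((Fintype.card ι : ℝ)⁻¹ * ∑ i, walkMass V (γ i)) := mul_le_mul_of_nonneg_left hmean (by positivity)
  linarith

/-- THE FRAME TO SECOND ORDER: `‖λ(V,y) − 1 − stairMeanLin(V,y)‖ ≤ 9ℓρ · stairMass(V,y)` and `‖λ(V,y) − 1‖ ≤ 5·stairMass(V,y)`.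
[folklore] -/
theorem frame_estimates (hρ : 0 ≤ ρ) (hV : ∀ b, dist1 (V b) ≤ ρ) (hδ : ell P * ρ < deltaSU n) (h2 : ell P * ρ ≤ 1 / 2)
    (y : Site P (j + 1)) :
    ‖((frame V y : Matrix.specialUnitaryGroup n ℂ) : MatA n) - 1 - stairMeanLin V y‖ ≤ 9 * (ell P * ρ) * stairMass V y ∧
      ‖((frame V y : Matrix.specialUnitaryGroup n ℂ) : MatA n) - 1‖ ≤ 5 * stairMass V y :=
  avg_hol_estimates V (fun i : Idx P => walk (emb y) (stairWord i.2.1 (off i.1))) (fun i => walkMass_stair_le V hρ hV y i) hδ h2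

/-- THE INVERSE FRAME TO SECOND ORDER: `‖λ(V,y)⁻¹ − 1 + stairMeanLin(V,y)‖ ≤ 34ℓρ · stairMass(V,y)` (the inverse lemma plus the frame
estimate; `‖λ − 1‖² ≤ 5·stairMass · 5ℓρ`). [folklore] -/
theorem frameInv_estimate (hρ : 0 ≤ ρ) (hV : ∀ b, dist1 (V b) ≤ ρ) (hδ : ell P * ρ < deltaSU n) (h2 : ell P * ρ ≤ 1 / 2)
    (y : Site P (j + 1)) :
    ‖(((frame V y)⁻¹ : Matrix.specialUnitaryGroup n ℂ) : MatA n) - 1 - (-stairMeanLin V y)‖ ≤ 34 * (ell P * ρ) * stairMass V y := by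
  obtain ⟨h9, h5⟩ := frame_estimates V hρ hV hδ h2 y
  have hsq := norm_coe_inv_sub_one_add_le (frame V y)
  have hsm : stairMass V y ≤ ell P * ρ := meanR_le_of_le fun i => walkMass_stair_le V hρ hV y i
  have hsm0 : 0 ≤ stairMass V y := meanR_nonneg fun i => walkMass_nonneg V _
  have hsplit : (((frame V y)⁻¹ : Matrix.specialUnitaryGroup n ℂ) : MatA n) - 1 - (-stairMeanLin V y)
      = ((((frame V y)⁻¹ : Matrix.specialUnitaryGroup n ℂ) : MatA n) - 1 + (((frame V y : Matrix.specialUnitaryGroup n ℂ) : MatA n) - 1))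
        - ((((frame V y : Matrix.specialUnitaryGroup n ℂ)) : MatA n) - 1 - stairMeanLin V y) := by abel
  rw [hsplit]
  refine (norm_sub_le _ _).trans ?_
  have hsq' : ‖((frame V y : Matrix.specialUnitaryGroup n ℂ) : MatA n) - 1‖ ^ 2 ≤ (5 * stairMass V y) * (5 * (ell P * ρ)) := by
    rw [pow_two]
    exact mul_le_mul h5 (h5.trans (by linarith)) (norm_nonneg _) (by linarith)
  nlinarith

/-- THE CORRECTION FACTOR IS ON THE SMALL-FIELD DOMAIN: every loop variable is within `ℓρ < δ_N` of the identity, so `corr = E(loop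
family)` ([Balaban1987RG1] (0.4) literally). [cite: Balaban1987RG1, (0.4) p.253] -/
theorem corr_eq_avg (hρ : 0 ≤ ρ) (hV : ∀ b, dist1 (V b) ≤ ρ) (hδ : ell P * ρ < deltaSU n) (c : PBond P (j + 1)) :
    corr (expMeanLogSU (n := n)) V c = (expMeanLogSU (n := n)).avg (loopHol V c) := by
  have hS : Small (expMeanLogSU (n := n)) V c := fun i =>
    ((dist1_holAt_le_walkMass V _).trans (walkMass_loop_le V hρ hV c i)).trans_lt hδ
  unfold corr
  rw [if_pos hS]

/-- THE CORRECTION FACTOR TO SECOND ORDER: `‖corr(c) − 1 − (stairMeanLin(c₋) + segMeanLin(c) − stairMeanLin(c₊) − axLin(c))‖ ≤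
9ℓρ · loopMass(c)` and `‖corr(c) − 1‖ ≤ 5·loopMass(c)`. [folklore] -/
theorem corr_estimates (hj : j + 1 ≤ P.m + P.K) (hρ : 0 ≤ ρ) (hV : ∀ b, dist1 (V b) ≤ ρ) (hδ : ell P * ρ < deltaSU n)
    (h2 : ell P * ρ ≤ 1 / 2) (c : PBond P (j + 1)) :
    ‖((corr (expMeanLogSU (n := n)) V c : Matrix.specialUnitaryGroup n ℂ) : MatA n) - 1
        - (stairMeanLin V c.src + segMeanLin V c - stairMeanLin V c.tgt - axLin V c)‖ ≤ 9 * (ell P * ρ) * loopMass V c ∧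
      ‖((corr (expMeanLogSU (n := n)) V c : Matrix.specialUnitaryGroup n ℂ) : MatA n) - 1‖ ≤ 5 * loopMass V c := by
  rw [corr_eq_avg V hρ hV hδ c, ← meanLin_loop hj V c]
  exact avg_hol_estimates V (fun i : Idx P => walk (emb c.src) (loopWord P.L c.dir (off i.1) i.2.1 i.2.2))
    (fun i => walkMass_loop_le V hρ hV c i) hδ h2

/-- THE SEGMENT TRANSPORTER TO SECOND ORDER: `‖U(c) − 1 − axLin(c)‖ ≤ ℓρ · axMass(c)` and `‖U(c) − 1‖ ≤ axMass(c)`. [folklore] -/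
theorem ax_estimates (hρ : 0 ≤ ρ) (hV : ∀ b, dist1 (V b) ≤ ρ) (c : PBond P (j + 1)) :
    ‖((axialAvg V c : Matrix.specialUnitaryGroup n ℂ) : MatA n) - 1 - axLin V c‖ ≤ (ell P * ρ) * axMass V c ∧
      ‖((axialAvg V c : Matrix.specialUnitaryGroup n ℂ) : MatA n) - 1‖ ≤ axMass V c := by
  rw [axialAvg_eq_holAt_walk]
  refine ⟨(norm_hol_sub_one_sub_walkLin_le V _).trans ?_, ?_⟩
  · rw [pow_two]
    exact mul_le_mul_of_nonneg_right (walkMass_ax_le V hρ hV _ _) (walkMass_nonneg V _)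
  · rw [← dist1_eq_norm]; exact dist1_holAt_le_walkMass V _

end Factors

/-! ## §4 The framed average to second order, per coarse bond -/

/-- **THE FRAMED AVERAGE TO SECOND ORDER** (per coarse bond): `‖F(V)(c) − 1 − segMeanLin(V,c)‖ ≤ 109·ℓρ·remMass(V,c)` — the staircase
means cancel against the frames and the segment against `U(c)` to first order; every factor's second-order defect and the cross
terms are `≤ ℓρ ×` (its mass). [folklore] -/
theorem norm_framed_sub_one_sub_le (hj : j + 1 ≤ P.m + P.K) (V : GaugeField P j (Matrix.specialUnitaryGroup n ℂ)) {ρ : ℝ}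
    (hρ : 0 ≤ ρ) (hV : ∀ b, dist1 (V b) ≤ ρ) (hδ : ell P * ρ < deltaSU n) (h2 : ell P * ρ ≤ 1 / 2) (c : PBond P (j + 1)) :
    ‖((framed V c : Matrix.specialUnitaryGroup n ℂ) : MatA n) - 1 - segMeanLin V c‖ ≤ 109 * (ell P * ρ) * remMass V c := by
  set η : ℝ := ell P * ρ with hη
  have hη0 : 0 ≤ η := by positivity
  obtain ⟨d1, _⟩ := frame_estimates V hρ hV hδ h2 c.src
  have d1' := frameInv_estimate V hρ hV hδ h2 c.src
  obtain ⟨d2, f2⟩ := corr_estimates V hj hρ hV hδ h2 c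
  obtain ⟨d3, f3⟩ := ax_estimates V hρ hV c
  obtain ⟨d4, f4⟩ := frame_estimates V hρ hV hδ h2 c.tgt
  have f1 : ‖(((frame V c.src)⁻¹ : Matrix.specialUnitaryGroup n ℂ) : MatA n) - 1‖ ≤ 5 * stairMass V c.src := by
    rw [norm_coe_inv_sub_one]; exact (frame_estimates V hρ hV hδ h2 c.src).2
  -- sizes
  have hs1 : stairMass V c.src ≤ η := meanR_le_of_le fun i => walkMass_stair_le V hρ hV _ i
  have hs2 : loopMass V c ≤ η := meanR_le_of_le fun i => walkMass_loop_le V hρ hV c i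
  have hs3 : axMass V c ≤ η := walkMass_ax_le V hρ hV _ _
  have hs4 : stairMass V c.tgt ≤ η := meanR_le_of_le fun i => walkMass_stair_le V hρ hV _ i
  have hp1 : 0 ≤ stairMass V c.src := meanR_nonneg fun i => walkMass_nonneg V _
  have hp2 : 0 ≤ loopMass V c := meanR_nonneg fun i => walkMass_nonneg V _
  have hp3 : 0 ≤ axMass V c := walkMass_nonneg V _
  have hp4 : 0 ≤ stairMass V c.tgt := meanR_nonneg fun i => walkMass_nonneg V _
  have key := norm_prod4_sub_one_sub_le_lin (Φ := 5 * η)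
    (le_of_eq (norm_coe_eq_one _)) (le_of_eq (norm_coe_eq_one _)) f1 f2 f3 f4
    (by linarith) (by linarith) (by linarith) (by linarith) d1' d2 d3 d4
  have hprod : ((framed V c : Matrix.specialUnitaryGroup n ℂ) : MatA n)
      = (((frame V c.src)⁻¹ : Matrix.specialUnitaryGroup n ℂ) : MatA n) * ((corr (expMeanLogSU (n := n)) V c : Matrix.specialUnitaryGroup n ℂ) : MatA n)
        * ((axialAvg V c : Matrix.specialUnitaryGroup n ℂ) : MatA n) * ((frame V c.tgt : Matrix.specialUnitaryGroup n ℂ) : MatA n) := by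
    rw [framed_apply]; simp only [Submonoid.coe_mul]
  have hlin : -stairMeanLin V c.src + (stairMeanLin V c.src + segMeanLin V c - stairMeanLin V c.tgt - axLin V c) + axLin V c
      + stairMeanLin V c.tgt = segMeanLin V c := by abel
  rw [hprod, ← hlin]
  refine key.trans ?_
  rw [remMass]
  nlinarith [mul_nonneg hη0 hp1, mul_nonneg hη0 hp2, mul_nonneg hη0 hp3, mul_nonneg hη0 hp4]

/-- The first-order term is bounded by the mean transported-bond mass. [folklore] -/
theorem norm_segMeanLin_le (V : GaugeField P j (Matrix.specialUnitaryGroup n ℂ)) (c : PBond P (j + 1)) :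
    ‖segMeanLin V c‖ ≤ segMass V c :=
  (norm_mean_le _).trans (meanR_mono fun _ => norm_walkLin_le V _)

/-- **PER-BOND DEVIATION OF THE FRAMED AVERAGE**: `dist1 F(V)(c) ≤ segMass(V,c) + 109ℓρ·remMass(V,c)`. [folklore] -/
theorem dist1_framed_le (hj : j + 1 ≤ P.m + P.K) (V : GaugeField P j (Matrix.specialUnitaryGroup n ℂ)) {ρ : ℝ}
    (hρ : 0 ≤ ρ) (hV : ∀ b, dist1 (V b) ≤ ρ) (hδ : ell P * ρ < deltaSU n) (h2 : ell P * ρ ≤ 1 / 2) (c : PBond P (j + 1)) :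
    dist1 (framed V c) ≤ segMass V c + 109 * (ell P * ρ) * remMass V c := by
  rw [dist1_eq_norm]
  have h := norm_framed_sub_one_sub_le hj V hρ hV hδ h2 c
  have hsplit : ((framed V c : Matrix.specialUnitaryGroup n ℂ) : MatA n) - 1
      = (((framed V c : Matrix.specialUnitaryGroup n ℂ) : MatA n) - 1 - segMeanLin V c) + segMeanLin V c := by abel
  rw [hsplit]
  exact (norm_add_le _ _).trans (by linarith [norm_segMeanLin_le V c])

/-- **SUP BOUND**: `dist1 F(V)(c) ≤ 16ℓρ` — the framed field lies in the sup-ball of radius `16ℓρ` (four factors of sizes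
`≤ 5ℓρ, 5ℓρ, ℓρ, 5ℓρ`). [folklore] -/
theorem dist1_framed_le_sup (hj : j + 1 ≤ P.m + P.K) (V : GaugeField P j (Matrix.specialUnitaryGroup n ℂ)) {ρ : ℝ}
    (hρ : 0 ≤ ρ) (hV : ∀ b, dist1 (V b) ≤ ρ) (hδ : ell P * ρ < deltaSU n) (h2 : ell P * ρ ≤ 1 / 2) (c : PBond P (j + 1)) :
    dist1 (framed V c) ≤ 16 * (ell P * ρ) := by
  have hs1 : stairMass V c.src ≤ ell P * ρ := meanR_le_of_le fun i => walkMass_stair_le V hρ hV _ i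
  have hs2 : loopMass V c ≤ ell P * ρ := meanR_le_of_le fun i => walkMass_loop_le V hρ hV c i
  have hs4 : stairMass V c.tgt ≤ ell P * ρ := meanR_le_of_le fun i => walkMass_stair_le V hρ hV _ i
  have f1 : dist1 (frame V c.src)⁻¹ ≤ 5 * (ell P * ρ) := by
    rw [GaugeGroup.dist1_inv, dist1_eq_norm]
    refine (frame_estimates V hρ hV hδ h2 c.src).2.trans ?_
    linarith
  have f2 : dist1 (corr (expMeanLogSU (n := n)) V c) ≤ 5 * (ell P * ρ) := by
    rw [dist1_eq_norm]
    refine (corr_estimates V hj hρ hV hδ h2 c).2.trans ?_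
    linarith
  have f3 : dist1 (axialAvg V c) ≤ ell P * ρ := by
    rw [dist1_eq_norm]
    exact (ax_estimates V hρ hV c).2.trans (walkMass_ax_le V hρ hV _ _)
  have f4 : dist1 (frame V c.tgt) ≤ 5 * (ell P * ρ) := by
    rw [dist1_eq_norm]
    refine (frame_estimates V hρ hV hδ h2 c.tgt).2.trans ?_
    linarith
  rw [framed_apply]
  calc dist1 ((frame V c.src)⁻¹ * corr (expMeanLogSU (n := n)) V c * axialAvg V c * frame V c.tgt)
      ≤ dist1 ((frame V c.src)⁻¹ * corr (expMeanLogSU (n := n)) V c * axialAvg V c) + dist1 (frame V c.tgt) :=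
        GaugeGroup.dist1_mul_le _ _
    _ ≤ dist1 ((frame V c.src)⁻¹ * corr (expMeanLogSU (n := n)) V c) + dist1 (axialAvg V c) + dist1 (frame V c.tgt) := by
        gcongr; exact GaugeGroup.dist1_mul_le _ _
    _ ≤ dist1 (frame V c.src)⁻¹ + dist1 (corr (expMeanLogSU (n := n)) V c) + dist1 (axialAvg V c) + dist1 (frame V c.tgt) := by
        gcongr; exact GaugeGroup.dist1_mul_le _ _
    _ ≤ 16 * (ell P * ρ) := by linarith

end SUN

end Summit.QuantumFields.BalabanUV.T4Continuum.Spine.NE7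

end
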